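import Summits.BirchSwinnertonDyer.Rank1Residual.X4.OptimalPeriod
import Literature.NumberTheory.EllipticCurves.KuriharaNumberKimShaLengthLocalTorsionTrivial
import HarnessLib

/-!
# Class X4, analytic rank `0`: the DEPTH-TWO twins of the Kim consumers (`n ∈ 𝒩₂`, `t ≤ 1`)
# (cell `bsd-addord`, seat `bsd-addord-k1-c3` gen 7; KIMT-3 exit, planner brief
# `pub/bsd-addord/planner/kimt/KIMT3-EXIT-BRIEF.md`; sibling of `X4/OptimalPeriod.lean` §3)

HONEST FRAMING: per-pair consumers; NOT a class theorem; nothing is booked here (the planner offers,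
referee A cuts); BSD for class X4 stays CONSTRUCTION-SHAPED. Nothing about any curve is asserted.

## What this module does (three theorems, no definition, no new named fact)

The rank-`0` Kim consumers of `X4/KuriharaClasswide.lean` §2 and `X4/OptimalPeriod.lean` §3
(`bsdp_iff_not_dvd_tamagawaProduct_of_kim_rankZero`, `bsdp_of_kim_rankZero_of_maninConstant`,
`bsdp_of_kim_rankZero_of_optimal`) consume the LEVEL-ONE named fact
`Kim2022_rankZero_padicValRat_sha_of_kuriharaNumber_ne_zero_of_maninConstant` (registry A56 / B7:
a unit Kurihara number at a level `n ∈ 𝒩₁`). On a pair with a local point of order `p`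
(`t := ord_p #E(ℚ_p)[p^∞] = 1`) that fact is flagged `K26-(6)-shallow@t>0` by the cited-literature
audit (ARM P, reader r10, referee A R351.5): the printed proof (Kim, Amer. J. Math. 148 (2026),
Thm. 3.11 / §5.4.1) sees a level-`n` certificate through `x_n = u·p^t·δ̃_n ∈ ℤ/p^{k(n)}`, which
vanishes when `k(n) = 1 = t`. The typer bsd-cited-ty2 landed the DEPTH-TWO twin of the fact
(`Kim2022_rankZero_padicValRat_sha_of_kuriharaNumber_ne_zero_of_maninConstant_depthTwo`, p470110,
`Literature/…/KuriharaNumberKimShaLengthLocalTorsionTrivial.lean`): the SAME statement with one extra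
binder `#E(ℚ_p)[p²] ≤ p` (`t ≤ 1`) and the level deepened to `n ∈ 𝒩₂`
(`Kato.IsKolyvaginProduct W p 2 n`: every `ℓ ∣ n` has `ℓ ≡ 1`, `a_ℓ ≡ ℓ + 1 (mod p²)`), value
binder unchanged (`δ̃_n ≢ 0 (mod p)`), weaker than B7 (bridge `…_depthTwo_of`, proved).

Here the three consumers are re-keyed on that twin, with the two binders threaded and NOTHING else
changed (same proof terms):

* `bsdp_iff_not_dvd_tamagawaProduct_of_kim_rankZero_depthTwo` — the exact boundary
  `BSD(E,p) ⟺ p ∤ ∏ c_ℓ` from ONE unit Kurihara number at a cyclic level `n ∈ 𝒩₂`;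
* `bsdp_of_kim_rankZero_of_maninConstant_depthTwo` — `+ p ∤ ∏ c_ℓ ⟹ BSD(E,p)`;
* `bsdp_of_kim_rankZero_of_optimal_depthTwo` — the period binder discharged by
  `periodTransfer_of_optimal` (optimal datum `D` with `p ∤ D.c`), exactly as `OptimalPeriod.lean`:296.

Where it bites: the three T-KIMADD `t = 1` rank-`0` pairs at the additive prime `5` with
`#Ш_an = 25` — `74100b1`, `80850br1`, `126350dh1` (level-one records
`X4.KimAdditiveRecordsExt.cert_X4ext_{74100b1,80850br1}_p5`,
`X4.KimAdditiveRecordsExtRankZero7.cert_X4ext_126350dh1_p5`; `E(ℚ₅)[5] ≅ ℤ/5` on all three,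
PARI j258547) — once a depth-two certificate (`n = ℓ₁ℓ₂`, `ℓᵢ ∈ 𝒫₂`, `δ̃_n ≢ 0 (mod 5)` on two
engines) is recorded. The `t ≤ 1` binder holds at every additive `p ≥ 5` (`E₁(ℚ_p)` torsion-free,
`E₀/E₁ ≅ 𝔽_p⁺`, `#Φ_p ≤ 4`) but is not yet a tree lemma, hence displayed.

References: C.-H. Kim, *The structure of Selmer groups and the Iwasawa main conjecture for elliptic
curves*, Amer. J. Math. 148 (2026), Thm. 1.8 (6), Thm. 3.11, §5.4.1 [Kim2022StructureSelmer];
R. L. Miller, LMS J. Comput. Math. 14 (2011), Def. 1.1 [Miller2011LMS]; A. Agashe, K. Ribet,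
W. Stein, *The Manin constant*, Pure Appl. Math. Q. 2 (2006), Thm. 2.6 / 5.2 [AgasheRibetStein2006].
-/

noncomputable section

open scoped Classical MatrixGroups ModularForm

open CongruenceSubgroup WeierstrassCurve Literature.NumberTheory.EllipticCurves
  Literature.NumberTheory.EllipticCurves.ModularForms
  Literature.NumberTheory.EllipticCurves.Rank1Residual
  Literature.NumberTheory.EllipticCurves.Rank1Residual.Typed

namespace Summit.BirchSwinnertonDyer.Rank1Residual.X4

variable (W : WeierstrassCurve ℚ) [W.IsElliptic] [W.IsGloballyMinimal] (p : ℕ) [Fact p.Prime]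

/-- **The exact boundary of the Kurihara route in analytic rank `0`, DEPTH-TWO level** (ANY
reduction at `p`, additive included): Kim 2026 Thm. 1.8 (6) in its depth-two shape (`hKim₂` =
`Kim2022_rankZero_padicValRat_sha_of_kuriharaNumber_ne_zero_of_maninConstant_depthTwo`) +
Gross–Zagier–Kolyvagin (`hGZK`). Per pair: `p ≥ 5`; `ρ̄_{E,p}` onto; `#E(ℚ_p)[p²] ≤ p` (`t ≤ 1`);
`L(E,1) ≠ 0`; a modular parametrisation datum `D` with `p ∤ D.maninConstant`; the period transfer
`Ω(W) = u·Ω⁺_{D.f}`, `|u|_p = 1`; a level `n ∈ 𝒩₂` with cyclic reductions `#Ẽ(𝔽_ℓ)[p] ≤ p`,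
surjective discrete logarithms `ψ_ℓ ↠ ℤ/p`, and ONE unit `kuriharaNumber D.f p n ψ`. Conclusion:
`BSD(E,p) ⟺ p ∤ ∏_ℓ c_ℓ`. Same proof as `bsdp_iff_not_dvd_tamagawaProduct_of_kim_rankZero`.
Per pair; NOT a class theorem.
[cite: Kim2022StructureSelmer, Thm. 1.8 (6), Thm. 3.11 and §5.4.1 (journal; = arXiv v4 Thm. 1.9 (6), PDF p. 8)]
[cite: Miller2011LMS, Def. 1.1] -/
theorem bsdp_iff_not_dvd_tamagawaProduct_of_kim_rankZero_depthTwo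
    (hKim₂ : Kim2022_rankZero_padicValRat_sha_of_kuriharaNumber_ne_zero_of_maninConstant_depthTwo)
    (hGZK : rank_eq_analyticRank_of_analyticRank_le_one) (hp : 5 ≤ p)
    (hsurj : W.HasSurjectiveModNGaloisRep p)
    (ht : Nat.card {Q : (W.baseChange ℚ_[p]).toAffine.Point // (p ^ 2 : ℕ) • Q = 0} ≤ p)
    (hL : W.entireLFunction 1 ≠ 0)
    {N : ℕ} [NeZero N] (D : ModularParametrizationData W N) (hc : ¬ (p : ℤ) ∣ D.maninConstant)
    (hper : ∃ u : ℚ, ‖(u : ℚ_[p])‖ = 1 ∧ W.realPeriodRat = u * plusPeriod D.f)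
    (n : ℕ) [NeZero n] (hn : Kato.IsKolyvaginProduct W p 2 n)
    (hcyc : ∀ (ℓ : ℕ) [Fact ℓ.Prime], ℓ ∣ n →
      Nat.card {P : ((WeierstrassCurve.integralModelInt W).map
          (Int.castRingHom (ZMod ℓ))).toAffine.Point // p • P = 0} ≤ p)
    (ψ : (ℓ : ℕ) → (ZMod ℓ)ˣ →* Multiplicative (ZMod (p ^ 1)))
    (hψ : ∀ ℓ ∈ n.primeFactors, Function.Surjective (ψ ℓ))
    (hδ : kuriharaNumber D.f (p ^ 1) n ψ ≠ 0) : BSDp W p ↔ ¬ p ∣ W.tamagawaProduct := by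
  have hr0 : W.analyticRank = 0 := analyticRank_eq_zero_of_entireLFunction_one_ne_zero hL
  obtain ⟨hmw, hfin⟩ := hGZK W (by rw [hr0]; exact zero_le_one)
  obtain ⟨q, hq, hval⟩ := hKim₂ W p hp hsurj ht hL hfin D hc hper n hn hcyc ψ hψ hδ
  exact bsdp_iff_not_dvd_tamagawaProduct_of_rankZero_witness W p hmw hfin hL
    (hasIrreducibleModPGaloisRep_of_hasSurjectiveModNGaloisRep W p hsurj) hq hval

/-- **Rank-`0` consumer at ANY prime `p ≥ 5`, additive included, DEPTH-TWO level**: the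
hypotheses of `bsdp_iff_not_dvd_tamagawaProduct_of_kim_rankZero_depthTwo` plus `p ∤ ∏_ℓ c_ℓ` give
Miller's `BSD(E,p)`. No torsion hypothesis (`ρ̄` onto ⇒ `p ∤ #E(ℚ)_tors`). Where it bites: the
three `t = 1` T-KIMADD rank-`0` pairs at the additive prime `5` (`74100b1`, `80850br1`,
`126350dh1`; `#Ш_an = 25`, `5 ∤ ∏ c_ℓ`) once a depth-two unit `δ̃_n` is certified. Per pair; NOT a
class theorem. [cite: Kim2022StructureSelmer, Thm. 1.8 (6), Thm. 3.11 (journal)]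
[cite: Miller2011LMS, Def. 1.1] -/
theorem bsdp_of_kim_rankZero_of_maninConstant_depthTwo
    (hKim₂ : Kim2022_rankZero_padicValRat_sha_of_kuriharaNumber_ne_zero_of_maninConstant_depthTwo)
    (hGZK : rank_eq_analyticRank_of_analyticRank_le_one) (hp : 5 ≤ p)
    (hsurj : W.HasSurjectiveModNGaloisRep p)
    (ht : Nat.card {Q : (W.baseChange ℚ_[p]).toAffine.Point // (p ^ 2 : ℕ) • Q = 0} ≤ p)
    (hL : W.entireLFunction 1 ≠ 0)
    {N : ℕ} [NeZero N] (D : ModularParametrizationData W N) (hc : ¬ (p : ℤ) ∣ D.maninConstant)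
    (hper : ∃ u : ℚ, ‖(u : ℚ_[p])‖ = 1 ∧ W.realPeriodRat = u * plusPeriod D.f)
    (htam : ¬ p ∣ W.tamagawaProduct)
    (n : ℕ) [NeZero n] (hn : Kato.IsKolyvaginProduct W p 2 n)
    (hcyc : ∀ (ℓ : ℕ) [Fact ℓ.Prime], ℓ ∣ n →
      Nat.card {P : ((WeierstrassCurve.integralModelInt W).map
          (Int.castRingHom (ZMod ℓ))).toAffine.Point // p • P = 0} ≤ p)
    (ψ : (ℓ : ℕ) → (ZMod ℓ)ˣ →* Multiplicative (ZMod (p ^ 1)))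
    (hψ : ∀ ℓ ∈ n.primeFactors, Function.Surjective (ψ ℓ))
    (hδ : kuriharaNumber D.f (p ^ 1) n ψ ≠ 0) : BSDp W p :=
  (bsdp_iff_not_dvd_tamagawaProduct_of_kim_rankZero_depthTwo W p hKim₂ hGZK hp hsurj ht hL D hc hper
    n hn hcyc ψ hψ hδ).mpr htam

/-- **Rank `0`, ANY reduction at `p` (additive included), OPTIMAL curve, DEPTH-TWO level**:
Kim 2026 Thm. 1.8 (6) in its depth-two shape (`hKim₂`) + Gross–Zagier–Kolyvagin (`hGZK`) with the
period binder supplied by `periodTransfer_of_optimal`: for `p ≥ 5`, `ρ̄` onto, `#E(ℚ_p)[p²] ≤ p`,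
`L(E,1) ≠ 0`, an OPTIMAL datum `D` with `p ∤ D.c`, `p ∤ ∏ c_ℓ`, and ONE unit Kurihara number at a
cyclic `𝒩₂`-level, Miller's `BSD(E,p)`. The depth-two twin of `bsdp_of_kim_rankZero_of_optimal`
(`X4/OptimalPeriod.lean`), same proof term with the two binders `ht`, `hn` threaded. The remaining
non-certificate input per pair is "`D` optimal with `p ∤ c`" — Agashe–Ribet–Stein 2006 Thm. 5.2 +
Thm. 2.6 for a Cremona `…1` curve. Per pair; NOT a class theorem.
[cite: Kim2022StructureSelmer, Thm. 1.8 (6), Thm. 3.11 and §1.3.5 (journal)]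
[cite: AgasheRibetStein2006, Thm. 2.6 and appendix Thm. 5.2] [cite: Miller2011LMS, Def. 1.1] -/
theorem bsdp_of_kim_rankZero_of_optimal_depthTwo
    (hKim₂ : Kim2022_rankZero_padicValRat_sha_of_kuriharaNumber_ne_zero_of_maninConstant_depthTwo)
    (hGZK : rank_eq_analyticRank_of_analyticRank_le_one) (hp : 5 ≤ p)
    (hsurj : W.HasSurjectiveModNGaloisRep p)
    (ht : Nat.card {Q : (W.baseChange ℚ_[p]).toAffine.Point // (p ^ 2 : ℕ) • Q = 0} ≤ p)
    (hL : W.entireLFunction 1 ≠ 0)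
    {N : ℕ} [NeZero N] (D : ModularParametrizationData W N)
    (hopt : ∀ z ∈ D.L.lattice, ∃ w ∈ periodLattice D.f, z = D.c * w)
    (hc : ¬ (p : ℤ) ∣ D.maninConstant) (htam : ¬ p ∣ W.tamagawaProduct)
    (n : ℕ) [NeZero n] (hn : Kato.IsKolyvaginProduct W p 2 n)
    (hcyc : ∀ (ℓ : ℕ) [Fact ℓ.Prime], ℓ ∣ n →
      Nat.card {P : ((WeierstrassCurve.integralModelInt W).map
          (Int.castRingHom (ZMod ℓ))).toAffine.Point // p • P = 0} ≤ p)
    (ψ : (ℓ : ℕ) → (ZMod ℓ)ˣ →* Multiplicative (ZMod (p ^ 1)))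
    (hψ : ∀ ℓ ∈ n.primeFactors, Function.Surjective (ψ ℓ))
    (hδ : kuriharaNumber D.f (p ^ 1) n ψ ≠ 0) : BSDp W p :=
  bsdp_of_kim_rankZero_of_maninConstant_depthTwo W p hKim₂ hGZK hp hsurj ht hL D hc
    (periodTransfer_of_optimal p D hopt hc) htam n hn hcyc ψ hψ hδ

end Summit.BirchSwinnertonDyer.Rank1Residual.X4

end
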